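import Summits.AtomisticToContinuum.BoseEinsteinCondensation.Theorems.BECLatticeDepthHomotopyModeIdentificationOccupationLipschitz
import Literature.MathematicalPhysics.QuantumManyBody.PeriodicBoseGasEq317
import HarnessLib

/-!
# Route `BECLatticeDepthHomotopy`, support item `ModeIdentification` (stmt-AtomisticToContinuum-12408):
# for a non-negative translation-invariant periodic state the constant mode carries the largest
# eigenvalue of the one-particle density matrix, `λ_max(γ_Ψ) = ⟨Ψ, n₀ Ψ⟩`

Helper file (supports, does not close, stmt-AtomisticToContinuum-12408). This is the heart of the
mode identification `Λ(0) ≤ periodicCondensateNumber` of the route: the unique periodic ground state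
`Ψ₀` of the torus Hamiltonian is non-negative (Perron–Frobenius) and invariant under common
translations of all particles (uniqueness), and for such a state EVERY normalised one-body mode `φ` is
occupied at most as much as the constant mode `L^{-3/2} 1_cell`:

  `⟨φ, γ_{Ψ₀} φ⟩ ≤ ⟨φ₀, γ_{Ψ₀} φ₀⟩ = ⟨Ψ₀, n₀ Ψ₀⟩`,  i.e.  `λ_max(γ_{Ψ₀}) = n₀(Ψ₀)`

(`maxOccupation_indicator_le_condensateOccupation`; the reverse inequality is the definition of the
supremum). Penrose–Onsager / LSSY phrase this through plane waves (`γ` is diagonal in momentum and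
`n_p = ∫ g(r) e^{-ipr} dr ≤ ∫ g = n₀` for the non-negative translation-averaged kernel `g`); we run
the equivalent **Schur test**, which needs no Fourier analysis: with the slice kernel
`K_Y(x) = Ψ₀(x, Y) ≥ 0`, slice sums `S(Y) = ∫_cell K_Y` and row sums
`R(x) = ∫_{cell^n} K_Y(x) S(Y) dY`,

* `rowSum_eq_rowSum_zero` — translation invariance and periodicity make `R` CONSTANT
  (`R(x - u) = R(x)`: shift the fundamental cell `cell^{n+1}` by `(u, …, u)`,
  `lintegral_cellN_comp_add`);
* `condensateOccupation_eq_mul_rowSum_zero` — `⟨Ψ₀, n₀Ψ₀⟩ = (n+1) L⁻³ ∫_Y S(Y)² = (n+1) R(0)` (Tonelli);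
* `occupation_indicator_le_mul_rowSum_zero` — for `∫|φ|² = 1`:
  `⟨φ, γ φ⟩ = (n+1)∫_Y |∫_cell conj(φ) K_Y|² ≤ (n+1)∫_Y (∫|φ| K_Y)² ≤ (n+1)∫_Y S(Y) ∫|φ|²K_Y`
  (Cauchy–Schwarz in `L²(K_Y dx)`, `lintegral_mul_sq_le_mul_lintegral_sq_mul`)
  `= (n+1)∫|φ(x)|² R(x) dx = (n+1) R(0) ∫_cell|φ|² ≤ (n+1) R(0)`.

The state enters as a continuous `F : (ℝ³)^{n+1} → ℂ` with `F = |F|` pointwise (real, non-negative),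
`Lℤ³`-periodic in every particle and invariant under `X ↦ X + (u, …, u)`; the Feynman–Kac ground
state `periodicFKGroundState` has these properties (`fkGroundState_translate_eq`).

References: O. Penrose, L. Onsager, *Bose–Einstein condensation and liquid helium*, Phys. Rev. 104
(1956) 576, §4 (momentum-diagonal `σ₁` for translation-invariant systems) [PenroseOnsager1956];
E. H. Lieb, R. Seiringer, J. P. Solovej, J. Yngvason (2005), §1.2 (1.17)–(1.19) [LSSY2005].
-/

noncomputable section

namespace Summit.AtomisticToContinuum.BoseEinsteinCondensation.Theorems.ModeIdentification

open MeasureTheory Filter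
open scoped ENNReal NNReal Topology ComplexConjugate
open Literature.MathematicalPhysics.QuantumManyBody.BoseGas

variable {n : ℕ} {L : ℝ}

/-! ### Cauchy–Schwarz with a weight -/

/-- **Cauchy–Schwarz in `L²(w dμ)`**: `(∫ p w dμ)² ≤ (∫ w dμ) · ∫ p² w dμ` for `[0,∞]`-valued a.e.
measurable `p, w` (Hölder `2,2` for the measure `w dμ` against the constant `1`). [folklore] -/
theorem lintegral_mul_sq_le_mul_lintegral_sq_mul {α : Type*} [MeasurableSpace α] (μ : Measure α)
    {w p : α → ℝ≥0∞} (hw : AEMeasurable w μ) (hp : AEMeasurable p μ) :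
    (∫⁻ x, p x * w x ∂μ) ^ 2 ≤ (∫⁻ x, w x ∂μ) * ∫⁻ x, p x ^ 2 * w x ∂μ := by
  set ν := μ.withDensity w with hν
  have hpν : AEMeasurable p ν := hp.mono' (withDensity_absolutelyContinuous μ w)
  have h := ENNReal.lintegral_mul_le_Lp_mul_Lq ν Real.HolderConjugate.two_two hpν
    (g := fun _ => 1) aemeasurable_const
  simp only [Pi.mul_apply, mul_one, lintegral_const, ENNReal.rpow_two, one_pow, one_mul] at h
  have h1 : ∫⁻ x, p x ∂ν = ∫⁻ x, p x * w x ∂μ := by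
    rw [hν, lintegral_withDensity_eq_lintegral_mul₀ hw hp]
    simp only [Pi.mul_apply, mul_comm]
  have h2 : ∫⁻ x, p x ^ 2 ∂ν = ∫⁻ x, p x ^ 2 * w x ∂μ := by
    rw [hν, lintegral_withDensity_eq_lintegral_mul₀ hw (hp.pow_const 2)]
    simp only [Pi.mul_apply, mul_comm]
  have h3 : ν Set.univ = ∫⁻ x, w x ∂μ := by
    rw [hν, withDensity_apply _ MeasurableSet.univ, Measure.restrict_univ]
  rw [h1, h2, h3] at h
  calc (∫⁻ x, p x * w x ∂μ) ^ 2
      ≤ ((∫⁻ x, p x ^ 2 * w x ∂μ) ^ (1 / 2 : ℝ) * (∫⁻ x, w x ∂μ) ^ (1 / 2 : ℝ)) ^ 2 := by gcongr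
    _ = (∫⁻ x, w x ∂μ) * ∫⁻ x, p x ^ 2 * w x ∂μ := by
        rw [← ENNReal.mul_rpow_of_nonneg _ _ (by norm_num : (0 : ℝ) ≤ 1 / 2), ← ENNReal.rpow_two,
          ← ENNReal.rpow_mul]
        norm_num [mul_comm]

/-! ### Vector bookkeeping on `Config (n+1) = Space × Config n` -/

/-- The tail of a configuration is continuous. [folklore] -/
theorem continuous_vecTail : Continuous fun Z : Config (n + 1) => Matrix.vecTail Z :=
  continuous_pi fun i => continuous_apply i.succ

/-- Translating the tagged particle's partners: `(x, T + (u,…,u)) = (x - u, T) + (u, …, u)`. [folklore] -/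
theorem vecCons_add_const (x u : Space) (T : Config n) :
    (Matrix.vecCons x (T + fun _ => u) : Config (n + 1)) =
      Matrix.vecCons (x - u) T + fun _ => u := by
  funext i
  refine Fin.cases ?_ (fun j => ?_) i
  · simp
  · simp

/-- The tail of a common translate is the translated tail. [folklore] -/
theorem vecTail_add_const (Z : Config (n + 1)) (u : Space) :
    Matrix.vecTail (Z + fun _ => u) = Matrix.vecTail Z + fun _ => u := by
  funext j
  simp [Matrix.vecTail]

/-- A lattice translation of the tagged particle does not move the tail. [folklore] -/
theorem vecTail_add_single_zero (Z : Config (n + 1)) (e : Space) :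
    Matrix.vecTail (Z + Pi.single (0 : Fin (n + 1)) e) = Matrix.vecTail Z := by
  funext j
  simp [Matrix.vecTail, Fin.succ_ne_zero]

/-- A lattice translation of a partner moves the tail accordingly. [folklore] -/
theorem vecTail_add_single_succ (Z : Config (n + 1)) (j : Fin n) (e : Space) :
    Matrix.vecTail (Z + Pi.single j.succ e) = Matrix.vecTail Z + Pi.single j e := by
  funext i
  simp [Matrix.vecTail, Pi.single_apply, Fin.succ_inj]

/-- `(x, T + e_j ⊗ e) = (x, T) + e_{j+1} ⊗ e`. [folklore] -/
theorem vecCons_add_single (x : Space) (T : Config n) (j : Fin n) (e : Space) :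
    (Matrix.vecCons x (T + Pi.single j e) : Config (n + 1)) =
      Matrix.vecCons x T + Pi.single j.succ e := by
  funext i
  refine Fin.cases ?_ (fun i' => ?_) i
  · simp [(Fin.succ_ne_zero j).symm]
  · simp [Pi.single_apply, Fin.succ_inj]

/-! ### The row sums of the slice kernel of a translation-invariant periodic state are constant -/

section RowSum

variable {F : Config (n + 1) → ℂ}

/-- The slice kernel `(Y, x) ↦ |F(x, Y)|` of a continuous state is (jointly) measurable. [folklore] -/
theorem measurable_sliceKernel (hF : Continuous F) :
    Measurable fun p : Config n × Space => (‖F (Matrix.vecCons p.2 p.1)‖₊ : ℝ≥0∞) :=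
  (hF.comp (continuous_snd.matrixVecCons continuous_fst)).measurable.nnnorm.coe_nnreal_ennreal

/-- The slice sums `S(Y) = ∫_cell |F(y, Y)| dy` are measurable in `Y`. [folklore] -/
theorem measurable_sliceSum (L : ℝ) (hF : Continuous F) :
    Measurable fun Y : Config n => ∫⁻ y in cell L, (‖F (Matrix.vecCons y Y)‖₊ : ℝ≥0∞) :=
  (measurable_sliceKernel hF).lintegral_prod_right' (ν := volume.restrict (cell L))

/-- **The row sum as an integral over the `(n+1)`-particle cell**:
`R(x) = ∫_{cell^n} |F(x,Y)| (∫_cell |F(y,Y)| dy) dY = ∫_{cell^{n+1}} |F(x, tail Z)| |F(Z)| dZ`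
(Tonelli, `cell^{n+1} = cell × cell^n`). [folklore] -/
theorem rowSum_eq_lintegral_cellN_succ (L : ℝ) (hF : Continuous F) (x : Space) :
    (∫⁻ Y in cellN n L, (‖F (Matrix.vecCons x Y)‖₊ : ℝ≥0∞) *
        ∫⁻ y in cell L, (‖F (Matrix.vecCons y Y)‖₊ : ℝ≥0∞)) =
      ∫⁻ Z in cellN (n + 1) L,
        (‖F (Matrix.vecCons x (Matrix.vecTail Z))‖₊ : ℝ≥0∞) * (‖F Z‖₊ : ℝ≥0∞) := by
  have hG : Measurable fun Z : Config (n + 1) =>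
      (‖F (Matrix.vecCons x (Matrix.vecTail Z))‖₊ : ℝ≥0∞) * (‖F Z‖₊ : ℝ≥0∞) :=
    (hF.comp (continuous_const.matrixVecCons continuous_vecTail)).measurable.nnnorm
      |>.coe_nnreal_ennreal.mul hF.measurable.nnnorm.coe_nnreal_ennreal
  rw [lintegral_cellN_succ L hG]
  refine lintegral_congr fun Y => ?_
  have hy : Measurable fun y : Space => (‖F (Matrix.vecCons y Y)‖₊ : ℝ≥0∞) :=
    (hF.comp (continuous_id.matrixVecCons continuous_const)).measurable.nnnorm.coe_nnreal_ennreal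
  rw [← lintegral_const_mul _ hy]
  refine lintegral_congr fun y => ?_
  simp only [Matrix.tail_cons]

/-- The integrand `Z ↦ |F(x, tail Z)| |F(Z)|` of the row sum is `Lℤ³`-periodic in every particle
of `Z` when `F` is. [folklore] -/
theorem rowSum_integrand_periodic
    (hper : ∀ (X : Config (n + 1)) (i : Fin (n + 1)) (k : Fin 3),
      F (X + Pi.single i (EuclideanSpace.single k L)) = F X)
    (x : Space) (Z : Config (n + 1)) (i : Fin (n + 1)) (k : Fin 3) :
    (‖F (Matrix.vecCons x (Matrix.vecTail (Z + Pi.single i (EuclideanSpace.single k L))))‖₊ :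
        ℝ≥0∞) * (‖F (Z + Pi.single i (EuclideanSpace.single k L))‖₊ : ℝ≥0∞) =
      (‖F (Matrix.vecCons x (Matrix.vecTail Z))‖₊ : ℝ≥0∞) * (‖F Z‖₊ : ℝ≥0∞) := by
  rw [hper]
  congr 3
  refine Fin.cases ?_ (fun j => ?_) i
  · rw [vecTail_add_single_zero]
  · rw [vecTail_add_single_succ, vecCons_add_single, hper]

/-- A common translation `(u, …, u)` of `Z` turns the row-sum integrand at `x` into the one at
`x - u` (translation invariance of `F`). [folklore] -/
theorem rowSum_integrand_add_const (htrans : ∀ (u : Space) (X : Config (n + 1)), F (X + fun _ => u) = F X)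
    (x u : Space) (Z : Config (n + 1)) :
    (‖F (Matrix.vecCons x (Matrix.vecTail (Z + fun _ => u)))‖₊ : ℝ≥0∞) *
        (‖F (Z + fun _ => u)‖₊ : ℝ≥0∞) =
      (‖F (Matrix.vecCons (x - u) (Matrix.vecTail Z))‖₊ : ℝ≥0∞) * (‖F Z‖₊ : ℝ≥0∞) := by
  rw [htrans u Z, vecTail_add_const, vecCons_add_const, htrans]

/-- **The row sums of the slice kernel of a translation-invariant periodic state are constant**:
`R(x) = R(0)` for every `x ∈ ℝ³`, where `R(x) = ∫_{cell^n} |F(x,Y)| ∫_cell |F(y,Y)| dy dY`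
(shift the fundamental cell by `(x, …, x)`, `lintegral_cellN_comp_add`). [folklore] -/
theorem rowSum_eq_rowSum_zero (hL : 0 < L) (hF : Continuous F)
    (hper : ∀ (X : Config (n + 1)) (i : Fin (n + 1)) (k : Fin 3),
      F (X + Pi.single i (EuclideanSpace.single k L)) = F X)
    (htrans : ∀ (u : Space) (X : Config (n + 1)), F (X + fun _ => u) = F X) (x : Space) :
    (∫⁻ Y in cellN n L, (‖F (Matrix.vecCons x Y)‖₊ : ℝ≥0∞) *
        ∫⁻ y in cell L, (‖F (Matrix.vecCons y Y)‖₊ : ℝ≥0∞)) =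
      ∫⁻ Y in cellN n L, (‖F (Matrix.vecCons 0 Y)‖₊ : ℝ≥0∞) *
        ∫⁻ y in cell L, (‖F (Matrix.vecCons y Y)‖₊ : ℝ≥0∞) := by
  have key : ∀ x u : Space,
      (∫⁻ Y in cellN n L, (‖F (Matrix.vecCons (x - u) Y)‖₊ : ℝ≥0∞) *
          ∫⁻ y in cell L, (‖F (Matrix.vecCons y Y)‖₊ : ℝ≥0∞)) =
        ∫⁻ Y in cellN n L, (‖F (Matrix.vecCons x Y)‖₊ : ℝ≥0∞) *
          ∫⁻ y in cell L, (‖F (Matrix.vecCons y Y)‖₊ : ℝ≥0∞) := by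
    intro x u
    have h := lintegral_cellN_comp_add hL
      (G := fun Z => (‖F (Matrix.vecCons x (Matrix.vecTail Z))‖₊ : ℝ≥0∞) * (‖F Z‖₊ : ℝ≥0∞))
      (rowSum_integrand_periodic hper x) (fun _ => u)
    rw [rowSum_eq_lintegral_cellN_succ L hF, rowSum_eq_lintegral_cellN_succ L hF, ← h]
    exact lintegral_congr fun Z => (rowSum_integrand_add_const htrans x u Z).symm
  have h := key x x
  rw [sub_self] at h
  exact h.symm

end RowSum

/-! ### The two occupations through the row sums -/

section Occupations

variable {F : Config (n + 1) → ℂ}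

/-- For a real non-negative state the modulus of the slice mean is the integral of the modulus:
`‖∫_cell F(x,Y) dx‖ = ∫_cell |F(x,Y)| dx` (as an `ℝ≥0∞` identity; continuous `F`). [folklore] -/
theorem nnnorm_setIntegral_slice_eq (hF : Continuous F) (hreal : ∀ X, F X = (‖F X‖ : ℂ))
    (Y : Config n) :
    (‖∫ x in cell L, F (Matrix.vecCons x Y)‖₊ : ℝ≥0∞) =
      ∫⁻ x in cell L, (‖F (Matrix.vecCons x Y)‖₊ : ℝ≥0∞) := by
  -- adapted from `enorm_integral_slice_eq` (PeriodicCondensateCoherence.lean), `C¹` relaxed to `C⁰`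
  have hc : Continuous fun x : Space => ‖F (Matrix.vecCons x Y)‖ :=
    (hF.comp (continuous_id.matrixVecCons continuous_const)).norm
  have h1 : ∫ x in cell L, F (Matrix.vecCons x Y) =
      ((∫ x in cell L, ‖F (Matrix.vecCons x Y)‖ : ℝ) : ℂ) := by
    rw [← integral_complex_ofReal]
    exact integral_congr_ae (Eventually.of_forall fun x => hreal _)
  have hnn : 0 ≤ ∫ x in cell L, ‖F (Matrix.vecCons x Y)‖ := integral_nonneg fun x => norm_nonneg _
  rw [h1, ← enorm_eq_nnnorm, ← ofReal_norm, Complex.norm_real, Real.norm_of_nonneg hnn,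
    ofReal_integral_eq_lintegral_ofReal (integrableOn_cell hc)
      (Eventually.of_forall fun x => norm_nonneg _)]
  refine lintegral_congr fun x => ?_
  rw [ofReal_norm, enorm_eq_nnnorm]

/-- **The condensate occupation through the row sums**: for a continuous real non-negative,
periodic, translation-invariant state, `⟨F, n₀ F⟩ = (n+1) L⁻³ ∫_{cell^n} S(Y)² dY = (n+1) R(0)`
(`∫_Y S² = ∫_Y ∫_x K_Y(x) S(Y) = ∫_cell R = L³ R(0)`). [cite: LSSY2005, §1.2 (1.17)] -/
theorem condensateOccupation_eq_mul_rowSum_zero (hL : 0 < L) (hF : Continuous F)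
    (hreal : ∀ X, F X = (‖F X‖ : ℂ))
    (hper : ∀ (X : Config (n + 1)) (i : Fin (n + 1)) (k : Fin 3),
      F (X + Pi.single i (EuclideanSpace.single k L)) = F X)
    (htrans : ∀ (u : Space) (X : Config (n + 1)), F (X + fun _ => u) = F X) :
    condensateOccupation (n + 1) L F =
      (n + 1 : ℝ≥0∞) * ∫⁻ Y in cellN n L, (‖F (Matrix.vecCons 0 Y)‖₊ : ℝ≥0∞) *
        ∫⁻ y in cell L, (‖F (Matrix.vecCons y Y)‖₊ : ℝ≥0∞) := by
  have hL3 : ENNReal.ofReal L ^ 3 ≠ 0 := pow_ne_zero _ (by simpa using hL)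
  have hL3' : ENNReal.ofReal L ^ 3 ≠ ⊤ := ENNReal.pow_ne_top ENNReal.ofReal_ne_top
  rw [condensateOccupation_succ hL F]
  congr 1
  have hK := measurable_sliceKernel (n := n) hF
  have hS := measurable_sliceSum (n := n) L hF
  -- `∫_Y S(Y)² = ∫_Y ∫_x K_Y(x) S(Y)`
  have h1 : (∫⁻ Y in cellN n L, (‖∫ x in cell L, F (Matrix.vecCons x Y)‖₊ : ℝ≥0∞) ^ 2) =
      ∫⁻ Y in cellN n L, ∫⁻ x in cell L, (‖F (Matrix.vecCons x Y)‖₊ : ℝ≥0∞) *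
        ∫⁻ y in cell L, (‖F (Matrix.vecCons y Y)‖₊ : ℝ≥0∞) := by
    refine lintegral_congr fun Y => ?_
    have hy : Measurable fun y : Space => (‖F (Matrix.vecCons y Y)‖₊ : ℝ≥0∞) :=
      (hF.comp (continuous_id.matrixVecCons continuous_const)).measurable.nnnorm.coe_nnreal_ennreal
    rw [nnnorm_setIntegral_slice_eq hF hreal Y, sq, lintegral_mul_const _ hy]
  -- Tonelli: `= ∫_x R(x) = L³ R(0)`
  have h2 : (∫⁻ Y in cellN n L, ∫⁻ x in cell L, (‖F (Matrix.vecCons x Y)‖₊ : ℝ≥0∞) *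
        ∫⁻ y in cell L, (‖F (Matrix.vecCons y Y)‖₊ : ℝ≥0∞)) =
      ∫⁻ x in cell L, ∫⁻ Y in cellN n L, (‖F (Matrix.vecCons x Y)‖₊ : ℝ≥0∞) *
        ∫⁻ y in cell L, (‖F (Matrix.vecCons y Y)‖₊ : ℝ≥0∞) :=
    lintegral_lintegral_swap (hK.mul (hS.comp measurable_fst)).aemeasurable
  rw [h1, h2]
  simp_rw [rowSum_eq_rowSum_zero hL hF hper htrans]
  rw [setLIntegral_const, volume_cell, mul_comm _ (ENNReal.ofReal L ^ 3), ← mul_assoc,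
    ENNReal.inv_mul_cancel hL3 hL3', one_mul]

/-- **Every mode is occupied at most `(n+1) R(0)` in a real non-negative translation-invariant
periodic state** (the Schur test): for `∫_{ℝ³}|φ|² = 1`,
`⟨φ, γ_F φ⟩ ≤ (n+1) ∫_Y (∫_cell |φ| K_Y)² ≤ (n+1) ∫_Y S(Y) ∫_cell |φ|² K_Y = (n+1) ∫_cell |φ(x)|² R(x) dx`
`= (n+1) R(0) ∫_cell |φ|² ≤ (n+1) R(0)`. [cite: PenroseOnsager1956, §4] -/
theorem occupation_indicator_le_mul_rowSum_zero (hL : 0 < L) (hF : Continuous F)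
    (hper : ∀ (X : Config (n + 1)) (i : Fin (n + 1)) (k : Fin 3),
      F (X + Pi.single i (EuclideanSpace.single k L)) = F X)
    (htrans : ∀ (u : Space) (X : Config (n + 1)), F (X + fun _ => u) = F X)
    {φ : Space → ℂ} (hφ : AEStronglyMeasurable φ volume) (hφ1 : ∫⁻ x, (‖φ x‖₊ : ℝ≥0∞) ^ 2 = 1) :
    occupation (n + 1) φ ((cellN (n + 1) L).indicator F) ≤
      (n + 1 : ℝ≥0∞) * ∫⁻ Y in cellN n L, (‖F (Matrix.vecCons 0 Y)‖₊ : ℝ≥0∞) *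
        ∫⁻ y in cell L, (‖F (Matrix.vecCons y Y)‖₊ : ℝ≥0∞) := by
  rw [occupation_indicator_succ L φ F]
  refine mul_le_mul_right ?_ _
  have hK := measurable_sliceKernel (n := n) hF
  have hS := measurable_sliceSum (n := n) L hF
  have hKx : ∀ x : Space, Measurable fun Y : Config n => (‖F (Matrix.vecCons x Y)‖₊ : ℝ≥0∞) :=
    fun x => (hF.comp (continuous_const.matrixVecCons continuous_id)).measurable.nnnorm
      |>.coe_nnreal_ennreal
  have hKY : ∀ Y : Config n, Measurable fun x : Space => (‖F (Matrix.vecCons x Y)‖₊ : ℝ≥0∞) :=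
    fun Y => (hF.comp (continuous_id.matrixVecCons continuous_const)).measurable.nnnorm
      |>.coe_nnreal_ennreal
  have hp : AEMeasurable (fun x => (‖φ x‖₊ : ℝ≥0∞)) (volume.restrict (cell L)) :=
    hφ.restrict.aemeasurable.nnnorm.coe_nnreal_ennreal
  have hp2 : AEMeasurable (fun x => (‖φ x‖₊ : ℝ≥0∞) ^ 2) (volume.restrict (cell L)) :=
    hp.pow_const 2
  have hφcell : ∫⁻ x in cell L, (‖φ x‖₊ : ℝ≥0∞) ^ 2 ≤ 1 :=
    hφ1 ▸ setLIntegral_le_lintegral _ _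
  -- Step 1: each slice, `|∫ conj(φ) K_Y|² ≤ S(Y) ∫ |φ|² K_Y`
  have hslice : ∀ Y : Config n,
      (‖∫ x in cell L, conj (φ x) * F (Matrix.vecCons x Y)‖₊ : ℝ≥0∞) ^ 2 ≤
        (∫⁻ y in cell L, (‖F (Matrix.vecCons y Y)‖₊ : ℝ≥0∞)) *
          ∫⁻ x in cell L, (‖φ x‖₊ : ℝ≥0∞) ^ 2 * (‖F (Matrix.vecCons x Y)‖₊ : ℝ≥0∞) := by
    intro Y
    calc (‖∫ x in cell L, conj (φ x) * F (Matrix.vecCons x Y)‖₊ : ℝ≥0∞) ^ 2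
        ≤ (∫⁻ x in cell L, (‖conj (φ x) * F (Matrix.vecCons x Y)‖₊ : ℝ≥0∞)) ^ 2 := by
          gcongr; exact enorm_integral_le_lintegral_enorm _
      _ = (∫⁻ x in cell L, (‖φ x‖₊ : ℝ≥0∞) * (‖F (Matrix.vecCons x Y)‖₊ : ℝ≥0∞)) ^ 2 := by
          congr 1
          refine lintegral_congr fun x => ?_
          rw [nnnorm_mul, ENNReal.coe_mul, RCLike.nnnorm_conj]
      _ ≤ _ := lintegral_mul_sq_le_mul_lintegral_sq_mul _ (hKY Y).aemeasurable hp
  -- Step 2: integrate over `Y` and exchange the integrals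
  have hswap : AEMeasurable (Function.uncurry fun (Y : Config n) (x : Space) =>
      (∫⁻ y in cell L, (‖F (Matrix.vecCons y Y)‖₊ : ℝ≥0∞)) *
        ((‖φ x‖₊ : ℝ≥0∞) ^ 2 * (‖F (Matrix.vecCons x Y)‖₊ : ℝ≥0∞)))
      ((volume.restrict (cellN n L)).prod (volume.restrict (cell L))) :=
    (hS.comp measurable_fst).aemeasurable.mul (hp2.comp_snd.mul hK.aemeasurable)
  calc ∫⁻ Y in cellN n L, (‖∫ x in cell L, conj (φ x) * F (Matrix.vecCons x Y)‖₊ : ℝ≥0∞) ^ 2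
      ≤ ∫⁻ Y in cellN n L, (∫⁻ y in cell L, (‖F (Matrix.vecCons y Y)‖₊ : ℝ≥0∞)) *
          ∫⁻ x in cell L, (‖φ x‖₊ : ℝ≥0∞) ^ 2 * (‖F (Matrix.vecCons x Y)‖₊ : ℝ≥0∞) :=
        lintegral_mono fun Y => hslice Y
    _ = ∫⁻ Y in cellN n L, ∫⁻ x in cell L, (∫⁻ y in cell L, (‖F (Matrix.vecCons y Y)‖₊ : ℝ≥0∞)) *
          ((‖φ x‖₊ : ℝ≥0∞) ^ 2 * (‖F (Matrix.vecCons x Y)‖₊ : ℝ≥0∞)) := by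
        refine lintegral_congr fun Y => ?_
        rw [lintegral_const_mul'' _ (hp2.fun_mul (hKY Y).aemeasurable)]
    _ = ∫⁻ x in cell L, ∫⁻ Y in cellN n L, (∫⁻ y in cell L, (‖F (Matrix.vecCons y Y)‖₊ : ℝ≥0∞)) *
          ((‖φ x‖₊ : ℝ≥0∞) ^ 2 * (‖F (Matrix.vecCons x Y)‖₊ : ℝ≥0∞)) :=
        lintegral_lintegral_swap hswap
    _ = ∫⁻ x in cell L, (‖φ x‖₊ : ℝ≥0∞) ^ 2 *
          ∫⁻ Y in cellN n L, (‖F (Matrix.vecCons x Y)‖₊ : ℝ≥0∞) *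
            ∫⁻ y in cell L, (‖F (Matrix.vecCons y Y)‖₊ : ℝ≥0∞) := by
        refine lintegral_congr fun x => ?_
        rw [← lintegral_const_mul _ ((hKx x).fun_mul hS)]
        refine lintegral_congr fun Y => ?_
        ring
    _ = ∫⁻ x in cell L, (‖φ x‖₊ : ℝ≥0∞) ^ 2 *
          ∫⁻ Y in cellN n L, (‖F (Matrix.vecCons 0 Y)‖₊ : ℝ≥0∞) *
            ∫⁻ y in cell L, (‖F (Matrix.vecCons y Y)‖₊ : ℝ≥0∞) := by
        simp_rw [rowSum_eq_rowSum_zero hL hF hper htrans]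
    _ = (∫⁻ x in cell L, (‖φ x‖₊ : ℝ≥0∞) ^ 2) *
          ∫⁻ Y in cellN n L, (‖F (Matrix.vecCons 0 Y)‖₊ : ℝ≥0∞) *
            ∫⁻ y in cell L, (‖F (Matrix.vecCons y Y)‖₊ : ℝ≥0∞) :=
        lintegral_mul_const'' _ hp2
    _ ≤ 1 * ∫⁻ Y in cellN n L, (‖F (Matrix.vecCons 0 Y)‖₊ : ℝ≥0∞) *
            ∫⁻ y in cell L, (‖F (Matrix.vecCons y Y)‖₊ : ℝ≥0∞) := by gcongr
    _ = _ := one_mul _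

/-- **For a non-negative translation-invariant periodic state the constant mode carries `λ_max`**:
if `F : (ℝ³)^{n+1} → ℂ` is continuous, real and non-negative (`F = |F|`), `Lℤ³`-periodic in every
particle and invariant under common translations `X ↦ X + (u, …, u)` (`L > 0`), then
`λ_max(γ_F) = maxOccupation (n+1) (1_{cell^{n+1}} F) ≤ condensateOccupation (n+1) L F = ⟨F, n₀ F⟩`
(hence `=`, the constant mode being one of the modes). Schur test on the non-negative kernel with
constant row sums (`occupation_indicator_le_mul_rowSum_zero`,
`condensateOccupation_eq_mul_rowSum_zero`). This is the torus form of Penrose–Onsager's remark that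
for a translation-invariant system `σ₁` is diagonal in momentum with the zero mode on top.
[cite: PenroseOnsager1956, §4] -/
theorem maxOccupation_indicator_le_condensateOccupation (hL : 0 < L) {F : Config (n + 1) → ℂ}
    (hF : Continuous F) (hreal : ∀ X, F X = (‖F X‖ : ℂ))
    (hper : ∀ (X : Config (n + 1)) (i : Fin (n + 1)) (k : Fin 3),
      F (X + Pi.single i (EuclideanSpace.single k L)) = F X)
    (htrans : ∀ (u : Space) (X : Config (n + 1)), F (X + fun _ => u) = F X) :
    maxOccupation (n + 1) ((cellN (n + 1) L).indicator F) ≤ condensateOccupation (n + 1) L F := by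
  rw [condensateOccupation_eq_mul_rowSum_zero hL hF hreal hper htrans]
  exact iSup₂_le fun φ hφ => occupation_indicator_le_mul_rowSum_zero hL hF hper htrans hφ.1 hφ.2

end Occupations

end Summit.AtomisticToContinuum.BoseEinsteinCondensation.Theorems.ModeIdentification

end
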